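import Summits.FinalStateConjecture.FinalStateConjecture.Theses.DerivativeThrift
import HarnessLib

/-!
# Birth skeleton — crux stmt-FinalStateConjecture-17610 `Theses.DerivativeThrift.ThriftyKerrStability` (rank 2)
# line `birth` (skeleton registrar planner-skel-stmt-FinalStateConjecture-17610-0, 2026-08-17; BC3 of run/shared/lean/lens3/_common/BC.md)

The crux (FIXED, concluded BY NAME below): asymptotic stability of every sub-extremal Kerr `(M₀, a₀)`
from ONE-TIME smallness `𝔑_(2,1/2,1/2)(Φ) ≤ ε` of the `k = 2` receding-Kerr layer norm of a smooth open
embedding `Φ` of the single-Kerr hyperboloidal layer (`N = 1`, `Λ = 1`, centre `0`, lab time `τ`, scale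
`ℓ ≥ 4M₀`) into an MGHD of admissible data (image in `J⁺(ιX)`, achronal leaves), with the near-zone
conclusion: sub-extremal `(M′, a′)` within `η`, a late Kerr–Schild chart `Ψ` of `{r > r₊(M′,a′)}` into
`J⁺(range Φ)`, radii `R(σ) → ∞` with `truncDeviationCk … 2 (R σ) σ → 0`, Kerr time vector eventually
pushed forward future-directed.

## The cut: ORBITAL + (ORBITAL ⇒ ASYMPTOTIC), the energy-space architecture of soliton stability

The sibling proofs (DHRT arXiv:2104.08222, KS arXiv:2104.11857 + GKS arXiv:2205.14808, Hintz2026) prove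
boundedness and decay in ONE bootstrap at high regularity. The low-regularity technology this route
imports (dispersive / energy-space methods) organises asymptotic stability differently — Weinstein /
Martel–Merle for solitons: (1) ORBITAL stability with modulation in the natural low norm, then
(2) orbital ⇒ ASYMPTOTIC stability by a decay/rigidity mechanism run on a solution already known to stay
close to the family for all time (Martel–Merle, J. Math. Pures Appl. 79 (2000) 339–425 and Arch. Ration.
Mech. Anal. 157 (2001) 219–254: "orbital stability + Liouville ⇒ asymptotic stability in the energy
space"). This file types exactly that cut for the thrift crux, over the tree's consequence-form
vocabulary (`RecedingKerr.layer`, `Spacetime.recedingKerrInitialLayerNorm`, `Spacetime.IsLateChart`,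
`Spacetime.truncDeviationCk`, `Kerr.background`, `Kerr.timeVector`):

* `stub_thriftOrbital` (K — MODULATED ORBITAL STABILITY AT THRIFT REGULARITY; open-problem sized, the
  `k = 2` a-priori estimate uniform in time): for sub-extremal `(M₀, a₀)`, `ℓ ≥ 4M₀` and every `δ > 0`
  there is `ε > 0` such that an `ε`-thrifty layer `Φ` (crux hypotheses verbatim) is followed by an
  ORBITAL CERTIFICATE at level `δ`: modulated sub-extremal parameters `(M₂, a₂)`,
  `|M₂ − M₀| + |a₂ − a₀| ≤ δ`, a late Kerr–Schild chart `Ψ` on `Kerr.background M₂ a₂` into `J⁺(range Φ)`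
  after `τ′` with radii `R(σ) → ∞` such that the `C²` deviation on the truncated slabs
  `{t* = σ, r ≤ R(σ)}` stays `≤ δ` for ALL `σ ≥ τ′` (boundedness, NOT decay), Kerr time vector
  eventually pushed forward future-directed, AND — the far-field half of orbital stability, which a
  near-zone chart cannot express — beyond every event `q` of the development a `δ`-thrifty
  `(M₂, a₂)`-layer `Φ₂` of the same scale `ℓ` inside `J⁺(range Φ)` (`q ∉ J⁺(range Φ₂)`: the layer is not
  causally earlier than `q`; smooth open embedding, achronal leaves, `𝔑_(2,1/2,1/2)(Φ₂) ≤ δ`).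
  Why it might fail: on Kerr boundedness is entangled with integrated decay (superradiance, no globally
  timelike Killing field: barrier `KerrSuperradiance`), and every printed ILED for spin-2 on Kerr costs
  the two derivatives of the Chandrasekhar/DHR transformation or Teukolsky–Starobinsky
  (DafermosHolzegelRodnianskiTaylor2021; arXiv:1903.03859; arXiv:2007.07211) — exactly the route's
  why-might-fail, now isolated in its boundedness form; the flat-frame `p = 1/2` far fluxes of late
  layers must stay small although the flat leaves misread outgoing radiation at order `M/r` (route
  Numbers). Not implied by, and not implying, the crux cheaply: the crux's conclusion gives near-zone
  decay but no far fluxes on late layers; K gives no decay.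
* `stub_orbitalToAsymptotic` (C — ASYMPTOTIC STABILITY FROM ORBITAL STABILITY; XL/open-problem sized,
  the DECAY mechanism plus final gauge; NO one-time smallness is assumed — the statement stands alone):
  for sub-extremal `(M₀, a₀)`, `ℓ ≥ 4M₀`, `η > 0` there is `δ > 0` such that, in every MGHD of admissible
  data and for every region `S`, an orbital certificate at level `δ` relative to `S` (verbatim the
  conclusion body of K with `range Φ ↦ S`: modulated sub-extremal `(M₂, a₂)` within `δ`, a late chart
  into `J⁺(S)` with `C²` deviation `≤ δ` on `{t* = σ, r ≤ R(σ)}` for all `σ ≥ τ′`, `R → ∞`, future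
  orientation, and `δ`-thrifty complete `(M₂, a₂)`-layers of scale `ℓ` inside `J⁺(S)` beyond every event
  — each of which is its own far-flux budget for the radiation entering its future) yields the crux's
  conclusion relative to `S` (final sub-extremal `(M′, a′)` within `η` of `(M₀, a₀)`, late chart into
  `J⁺(S)`, `R′(σ) → ∞`, `truncDeviationCk … 2 (R′ σ) σ → 0`, future orientation). Mechanism: a-priori
  `δ`-closeness to ONE fixed sub-extremal Kerr for all time makes the problem perturbative forever;
  integrated local energy decay + the `r^p` hierarchy run from the late complete hyperboloidal layers
  (DafermosRodnianski2010ICMP, Moschidis2016; arXiv:1402.7034, the full sub-extremal scalar model) convert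
  "bounded forever and radiating through complete leaves" into "decays in the near zone"; final
  parameters by summable fluxes; one global late chart by patching the late layers' near frames
  (rigidity of `C²`-near-isometries of Kerr near zones). Why it might fail: parameter convergence at
  `p = 1/2` (angular-momentum flux not signed, energy flux only `t^(−1/2)`-summable-in-kind); `C²` (sup)
  decay out to GROWING radii from flux-level (`H¹`-type) far control needs a regularity gain the thrift
  budget may not afford; the gaps between the certificate's late layers are unbounded, so the prover
  must re-run semi-global Cauchy stability from each of them at thrift regularity. The crux does NOT
  imply C cheaply (its `ε` is not uniform in the centre `(M₂, a₂)`, and `ℓ ≥ 4M₂` may fail), and C does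
  not imply the crux without K.

Composition `ThriftyKerrStability_of : Sig.stub_thriftOrbital → Sig.stub_orbitalToAsymptotic →
ThriftyKerrStability` is genuine `ε/δ` plumbing (C's `δ(η)` feeds K's tolerance, K's `ε(δ)` is the
crux's `ε`; K's certificate in `J⁺(range Φ)` is handed to C at the region `S := range Φ`), kernel-checked,
no `sorry`; and `thriftyKerrStability_of_stubs : ThriftyKerrStability` = the crux BY NAME modulo the two
stubs.
The `Sig.*` legend = the stub signatures verbatim (named binders for the implication form); the
registered stubs themselves are DEF-FREE and self-contained via `open … in`.

Disproof.lean: none exists for this crux (`ledger crux ls stmt-FinalStateConjecture-17610`: no workfiles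
at registration) — no `_false_without_` obligations to honour. Negatives index (1 entry,
`not_UniformPhotonSphereChannels`): unrelated ODE channel estimate. Neither stub is an instance of it.
-/

set_option linter.dupNamespace false

noncomputable section

open scoped Manifold ContDiff Topology ENNReal
open Filter Set Function Literature.Geometry.Lorentzian

namespace Summit.FinalStateConjecture.FinalStateConjecture.Cruxes.ThriftyKerrStability.Birth

open Summit.FinalStateConjecture.FinalStateConjecture.Theses.DerivativeThrift (ThriftyKerrStability)

/-! ## Legend: the two stub statements as named propositions (verbatim the registered signatures) -/

/-- Statement of `stub_thriftOrbital` (K): one-time `ε`-thrift ⇒ an orbital certificate at level `δ`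
(modulated parameters, late near-zone chart with `C²` deviation `≤ δ` for all later chart times, future
orientation, and `δ`-thrifty modulated layers beyond every event). -/
def Sig.stub_thriftOrbital : Prop :=
  open Literature.Geometry.Lorentzian in open scoped Manifold ContDiff in ∀ (M₀ a₀ : ℝ), Kerr.IsSubextremal M₀ a₀ → ∀ ℓ : ℝ, 4 * M₀ ≤ ℓ → ∀ δ : ℝ, 0 < δ → ∃ ε : ℝ, 0 < ε ∧ ∀ (X : Type) [TopologicalSpace X] [ChartedSpace E3 X] [IsManifold (𝓡 3) ∞ X] [T2Space X] [SecondCountableTopology X] [ConnectedSpace X] (D : InitialDataSet (𝓡 3) X), D ∈ admissibleVacuumData X → ∀ 𝒟 : VacuumCauchyDevelopment D, 𝒟.IsMaximal → ∀ (τ : ℝ) (Φ : RecedingKerr.layer (fun _ : Fin 1 ↦ M₀) (fun _ ↦ a₀) (fun _ ↦ 1) (fun _ ↦ 0) τ ℓ → 𝒟.carrier), ContMDiff 𝓘(ℝ, E4) (𝓡 4) ∞ Φ → Topology.IsOpenEmbedding Φ → Set.range Φ ⊆ 𝒟.metric.causalFuture 𝒟.timeOrientation (Set.range 𝒟.embed)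 → (∀ s₀ ∈ Set.Ioo 0 ℓ, 𝒟.metric.IsAchronal 𝒟.timeOrientation (Φ '' {x | RecedingKerr.layerTime τ ℓ x.1 = s₀})) → 𝒟.toSpacetime.recedingKerrInitialLayerNorm (fun _ : Fin 1 ↦ M₀) (fun _ ↦ a₀) (fun _ ↦ 1) (fun _ ↦ 0) τ ℓ 2 (1 / 2) (1 / 2) Φ ≤ ENNReal.ofReal ε → ∃ (M₂ a₂ τ' : ℝ) (Ψ : (Kerr.background M₂ a₂).domain → 𝒟.carrier) (R : ℝ → ℝ), Kerr.IsSubextremal M₂ a₂ ∧ |M₂ - M₀| + |a₂ - a₀| ≤ δ ∧ 𝒟.toSpacetime.IsLateChart (Kerr.background M₂ a₂) (𝒟.metric.causalFuture 𝒟.timeOrientation (Set.range Φ)) τ' Ψ ∧ Filter.Tendsto R Filter.atTop Filter.atTop ∧ (∀ σ : ℝ, τ' ≤ σ → 𝒟.toSpacetime.truncDeviationCk (Kerr.background M₂ a₂) Ψ 2 (R σ) σ ≤ ENNReal.ofReal δ) ∧ (∀ ρ : ℝ, ∀ᶠ σ in Filter.atTop, ∀ x ∈ (Kerr.background M₂ a₂).truncTimeSlab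 ρ σ, 𝒟.timeOrientation.IsFutureDirected (mfderiv 𝓘(ℝ, E4) (𝓡 4) Ψ x (Kerr.timeVector M₂ a₂ (x : E4)))) ∧ ∀ q : 𝒟.carrier, ∃ (τ₂ : ℝ) (Φ₂ : RecedingKerr.layer (fun _ : Fin 1 ↦ M₂) (fun _ ↦ a₂) (fun _ ↦ 1) (fun _ ↦ 0) τ₂ ℓ → 𝒟.carrier), ContMDiff 𝓘(ℝ, E4) (𝓡 4) ∞ Φ₂ ∧ Topology.IsOpenEmbedding Φ₂ ∧ Set.range Φ₂ ⊆ 𝒟.metric.causalFuture 𝒟.timeOrientation (Set.range Φ) ∧ (∀ s₀ ∈ Set.Ioo 0 ℓ, 𝒟.metric.IsAchronal 𝒟.timeOrientation (Φ₂ '' {x | RecedingKerr.layerTime τ₂ ℓ x.1 = s₀})) ∧ 𝒟.toSpacetime.recedingKerrInitialLayerNorm (fun _ : Fin 1 ↦ M₂) (fun _ ↦ a₂) (fun _ ↦ 1) (fun _ ↦ 0) τ₂ ℓ 2 (1 / 2) (1 / 2) Φ₂ ≤ ENNReal.ofReal δ ∧ q ∉ 𝒟.metric.causalFuture 𝒟.timeOrientation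 (Set.range Φ₂)

/-- Statement of `stub_orbitalToAsymptotic` (C): in any region `S`, an orbital certificate at level `δ`
(verbatim K's conclusion with `range Φ ↦ S`) ⇒ the crux's near-zone conclusion relative to `S` (final
sub-extremal Kerr within `η`, late chart into `J⁺(S)`, decay out to growing radii, future orientation). -/
def Sig.stub_orbitalToAsymptotic : Prop :=
  open Literature.Geometry.Lorentzian in open scoped Manifold ContDiff in ∀ (M₀ a₀ : ℝ), Kerr.IsSubextremal M₀ a₀ → ∀ ℓ : ℝ, 4 * M₀ ≤ ℓ → ∀ η : ℝ, 0 < η → ∃ δ : ℝ, 0 < δ ∧ ∀ (X : Type) [TopologicalSpace X] [ChartedSpace E3 X] [IsManifold (𝓡 3) ∞ X] [T2Space X] [SecondCountableTopology X] [ConnectedSpace X] (D : InitialDataSet (𝓡 3) X), D ∈ admissibleVacuumData X → ∀ 𝒟 : VacuumCauchyDevelopment D, 𝒟.IsMaximal → ∀ (S : Set 𝒟.carrier) (M₂ a₂ τ' : ℝ) (Ψ : (Kerr.background M₂ a₂).domain → 𝒟.carrier) (R : ℝ → ℝ), (Kerr.IsSubextremal M₂ a₂ ∧ |M₂ - M₀|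 + |a₂ - a₀| ≤ δ ∧ 𝒟.toSpacetime.IsLateChart (Kerr.background M₂ a₂) (𝒟.metric.causalFuture 𝒟.timeOrientation S) τ' Ψ ∧ Filter.Tendsto R Filter.atTop Filter.atTop ∧ (∀ σ : ℝ, τ' ≤ σ → 𝒟.toSpacetime.truncDeviationCk (Kerr.background M₂ a₂) Ψ 2 (R σ) σ ≤ ENNReal.ofReal δ) ∧ (∀ ρ : ℝ, ∀ᶠ σ in Filter.atTop, ∀ x ∈ (Kerr.background M₂ a₂).truncTimeSlab ρ σ, 𝒟.timeOrientation.IsFutureDirected (mfderiv 𝓘(ℝ, E4) (𝓡 4) Ψ x (Kerr.timeVector M₂ a₂ (x : E4)))) ∧ ∀ q : 𝒟.carrier, ∃ (τ₂ : ℝ) (Φ₂ : RecedingKerr.layer (fun _ : Fin 1 ↦ M₂) (fun _ ↦ a₂) (fun _ ↦ 1) (fun _ ↦ 0) τ₂ ℓ → 𝒟.carrier), ContMDiff 𝓘(ℝ, E4) (𝓡 4) ∞ Φ₂ ∧ Topology.IsOpenEmbedding Φ₂ ∧ Set.range Φ₂ ⊆ 𝒟.metric.causalFuture 𝒟.timeOrientation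 S ∧ (∀ s₀ ∈ Set.Ioo 0 ℓ, 𝒟.metric.IsAchronal 𝒟.timeOrientation (Φ₂ '' {x | RecedingKerr.layerTime τ₂ ℓ x.1 = s₀})) ∧ 𝒟.toSpacetime.recedingKerrInitialLayerNorm (fun _ : Fin 1 ↦ M₂) (fun _ ↦ a₂) (fun _ ↦ 1) (fun _ ↦ 0) τ₂ ℓ 2 (1 / 2) (1 / 2) Φ₂ ≤ ENNReal.ofReal δ ∧ q ∉ 𝒟.metric.causalFuture 𝒟.timeOrientation (Set.range Φ₂)) → ∃ (M' a' τ'' : ℝ) (Ψ' : (Kerr.background M' a').domain → 𝒟.carrier) (R' : ℝ → ℝ), Kerr.IsSubextremal M' a' ∧ |M' - M₀| + |a' - a₀| ≤ η ∧ 𝒟.toSpacetime.IsLateChart (Kerr.background M' a') (𝒟.metric.causalFuture 𝒟.timeOrientation S) τ'' Ψ' ∧ Filter.Tendsto R' Filter.atTop Filter.atTop ∧ Filter.Tendsto (fun σ ↦ 𝒟.toSpacetime.truncDeviationCk (Kerr.background M' a') Ψ' 2 (R' σ) σ) Filter.atTop (nhds 0) ∧ ∀ ρ : ℝ, ∀ᶠ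 σ in Filter.atTop, ∀ x ∈ (Kerr.background M' a').truncTimeSlab ρ σ, 𝒟.timeOrientation.IsFutureDirected (mfderiv 𝓘(ℝ, E4) (𝓡 4) Ψ' x (Kerr.timeVector M' a' (x : E4)))

/-! ## Registered stubs (`sorry` only here; signatures def-free and self-contained) -/

/-- **K — MODULATED ORBITAL STABILITY AT THRIFT REGULARITY** (the boundedness half of the crux, in the
Weinstein/Martel–Merle architecture "orbital, then asymptotic"; the `k = 2` a-priori estimate, uniform in
time). For sub-extremal `(M₀, a₀)`, `ℓ ≥ 4M₀` and `δ > 0` there is `ε > 0` such that: in every MGHD of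
admissible data, every smooth open embedding `Φ` of the single-Kerr layer
`RecedingKerr.layer (M₀) (a₀) 1 0 τ ℓ` with image in `J⁺(ιX)`, achronal leaves and
`𝔑_(2,1/2,1/2)(Φ) ≤ ε` is followed by an ORBITAL CERTIFICATE at level `δ`: sub-extremal `(M₂, a₂)` with
`|M₂ − M₀| + |a₂ − a₀| ≤ δ`; a late chart `Ψ` on `Kerr.background M₂ a₂` into `J⁺(range Φ)` after `τ′`
(`Spacetime.IsLateChart`) and radii `R(σ) → ∞` with `truncDeviationCk … Ψ 2 (R σ) σ ≤ δ` for ALL `σ ≥ τ′`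
(uniform `C²` closeness on growing near zones — no decay claimed); the push-forward of
`Kerr.timeVector M₂ a₂` eventually future-directed on every `{t* = σ, r ≤ ρ}`; and, beyond every event
`q` (`q ∉ J⁺(range Φ₂)`), a smooth open embedding `Φ₂` of the `(M₂, a₂)`-layer of the same scale `ℓ` at
some lab time `τ₂`, image in `J⁺(range Φ)`, achronal leaves, `𝔑_(2,1/2,1/2)(Φ₂) ≤ δ` (far-flux
smallness persists on arbitrarily late complete hyperboloidal layers). Why it might fail: boundedness on
Kerr is entangled with ILED (superradiance); printed spin-2 ILED costs the two transformation
derivatives (DHR `P = ∇∇α`, Teukolsky–Starobinsky; arXiv:1903.03859, arXiv:2007.07211), i.e. more than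
the thrift budget; flat-frame `p = 1/2` fluxes of late layers misread outgoing radiation at order `M/r`.
Sources: DafermosHolzegelRodnianskiTaylor2021 (arXiv:2104.08222), KlainermanSzeftel2023
(arXiv:2104.11857, §3.6), Hintz2026, DafermosRodnianski2010ICMP, Moschidis2016, Tohaneanu2009,
MarzuolaEtAl2008, LindbladEtAl2013; Martel–Merle, Arch. Ration. Mech. Anal. 157 (2001) (architecture).
Size: open-problem. -/
theorem stub_thriftOrbital : open Literature.Geometry.Lorentzian in open scoped Manifold ContDiff in ∀ (M₀ a₀ : ℝ), Kerr.IsSubextremal M₀ a₀ → ∀ ℓ : ℝ, 4 * M₀ ≤ ℓ → ∀ δ : ℝ, 0 < δ → ∃ ε : ℝ, 0 < ε ∧ ∀ (X : Type) [TopologicalSpace X] [ChartedSpace E3 X] [IsManifold (𝓡 3) ∞ X] [T2Space X] [SecondCountableTopology X] [ConnectedSpace X] (D : InitialDataSet (𝓡 3) X), D ∈ admissibleVacuumData X → ∀ 𝒟 : VacuumCauchyDevelopment D, 𝒟.IsMaximal → ∀ (τ : ℝ) (Φ : RecedingKerr.layer (fun _ : Fin 1 ↦ M₀) (fun _ ↦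 a₀) (fun _ ↦ 1) (fun _ ↦ 0) τ ℓ → 𝒟.carrier), ContMDiff 𝓘(ℝ, E4) (𝓡 4) ∞ Φ → Topology.IsOpenEmbedding Φ → Set.range Φ ⊆ 𝒟.metric.causalFuture 𝒟.timeOrientation (Set.range 𝒟.embed) → (∀ s₀ ∈ Set.Ioo 0 ℓ, 𝒟.metric.IsAchronal 𝒟.timeOrientation (Φ '' {x | RecedingKerr.layerTime τ ℓ x.1 = s₀})) → 𝒟.toSpacetime.recedingKerrInitialLayerNorm (fun _ : Fin 1 ↦ M₀) (fun _ ↦ a₀) (fun _ ↦ 1) (fun _ ↦ 0) τ ℓ 2 (1 / 2) (1 / 2) Φ ≤ ENNReal.ofReal ε → ∃ (M₂ a₂ τ' : ℝ) (Ψ : (Kerr.background M₂ a₂).domain → 𝒟.carrier) (R : ℝ → ℝ), Kerr.IsSubextremal M₂ a₂ ∧ |M₂ - M₀| + |a₂ - a₀| ≤ δ ∧ 𝒟.toSpacetime.IsLateChart (Kerr.background M₂ a₂) (𝒟.metric.causalFuture 𝒟.timeOrientation (Set.range Φ)) τ' Ψ ∧ Filter.Tendsto R Filter.atTop Filter.atTop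 ∧ (∀ σ : ℝ, τ' ≤ σ → 𝒟.toSpacetime.truncDeviationCk (Kerr.background M₂ a₂) Ψ 2 (R σ) σ ≤ ENNReal.ofReal δ) ∧ (∀ ρ : ℝ, ∀ᶠ σ in Filter.atTop, ∀ x ∈ (Kerr.background M₂ a₂).truncTimeSlab ρ σ, 𝒟.timeOrientation.IsFutureDirected (mfderiv 𝓘(ℝ, E4) (𝓡 4) Ψ x (Kerr.timeVector M₂ a₂ (x : E4)))) ∧ ∀ q : 𝒟.carrier, ∃ (τ₂ : ℝ) (Φ₂ : RecedingKerr.layer (fun _ : Fin 1 ↦ M₂) (fun _ ↦ a₂) (fun _ ↦ 1) (fun _ ↦ 0) τ₂ ℓ → 𝒟.carrier), ContMDiff 𝓘(ℝ, E4) (𝓡 4) ∞ Φ₂ ∧ Topology.IsOpenEmbedding Φ₂ ∧ Set.range Φ₂ ⊆ 𝒟.metric.causalFuture 𝒟.timeOrientation (Set.range Φ) ∧ (∀ s₀ ∈ Set.Ioo 0 ℓ, 𝒟.metric.IsAchronal 𝒟.timeOrientation (Φ₂ '' {x | RecedingKerr.layerTime τ₂ ℓ x.1 = s₀})) ∧ 𝒟.toSpacetime.recedingKerrInitialLayerNorm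 (fun _ : Fin 1 ↦ M₂) (fun _ ↦ a₂) (fun _ ↦ 1) (fun _ ↦ 0) τ₂ ℓ 2 (1 / 2) (1 / 2) Φ₂ ≤ ENNReal.ofReal δ ∧ q ∉ 𝒟.metric.causalFuture 𝒟.timeOrientation (Set.range Φ₂) := by
  sorry

/-- **C — ASYMPTOTIC STABILITY FROM ORBITAL STABILITY** (the decay half of the crux plus the final
gauge; Martel–Merle's "orbital + rigidity ⇒ asymptotic" step, here for vacuum Einstein near sub-extremal
Kerr at thrift regularity; self-standing — no one-time smallness hypothesis). For sub-extremal
`(M₀, a₀)`, `ℓ ≥ 4M₀` and `η > 0` there is `δ > 0` such that: in every MGHD `𝒟` of admissible data and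
for every region `S ⊆ 𝒟`, an ORBITAL CERTIFICATE at level `δ` relative to `S` — sub-extremal `(M₂, a₂)`
with `|M₂ − M₀| + |a₂ − a₀| ≤ δ`; a late chart `Ψ` on `Kerr.background M₂ a₂` into `J⁺(S)` after `τ′`
with radii `R(σ) → ∞` and `truncDeviationCk … Ψ 2 (R σ) σ ≤ δ` for all `σ ≥ τ′`; the push-forward of
`Kerr.timeVector M₂ a₂` eventually future-directed on every `{t* = σ, r ≤ ρ}`; and beyond every event `q`
(`q ∉ J⁺(range Φ₂)`) a smooth open embedding `Φ₂` of the `(M₂, a₂)`-layer of scale `ℓ`, image in `J⁺(S)`,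
achronal leaves, `𝔑_(2,1/2,1/2)(Φ₂) ≤ δ` (verbatim the conclusion of K with `range Φ ↦ S`) — yields the
crux's conclusion relative to `S`: sub-extremal `(M′, a′)` with `|M′ − M₀| + |a′ − a₀| ≤ η`, a late chart
`Ψ′` on `Kerr.background M′ a′` into `J⁺(S)` after `τ″`, radii `R′(σ) → ∞` with
`truncDeviationCk … Ψ′ 2 (R′ σ) σ → 0`, and the push-forward of `Kerr.timeVector M′ a′` eventually
future-directed on every `{t* = σ, r ≤ ρ}`. Mechanism: a-priori `δ`-closeness to ONE fixed sub-extremal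
Kerr for all time makes the problem perturbative forever; ILED + `r^p` run from the late complete
hyperboloidal layers, each its own far-flux budget for the radiation entering its future
(DafermosRodnianski2010ICMP, Moschidis2016; full sub-extremal scalar model arXiv:1402.7034), turn
"bounded and radiating through complete leaves" into near-zone decay; final parameters from summable
fluxes; one late chart by patching the late layers' near frames (rigidity of `C²`-near-isometries of
Kerr near zones; transitivity `J⁺(J⁺(S)) ⊆ J⁺(S)`). Why it might fail: parameter convergence at `p = 1/2`
(angular-momentum flux unsigned, energy decay only `t^(−1/2)`-level); `C²` sup decay out to growing radii
from flux-level far control needs a regularity gain; unbounded gaps between the certificate's late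
layers force semi-global Cauchy stability at thrift regularity from each of them. Sources:
DafermosHolzegelRodnianskiTaylor2021, KlainermanSzeftel2023, Hintz2026 (Thm 13.1, rates),
DafermosRodnianski2010ICMP, Moschidis2016, arXiv:1402.7034, Bieri2010JDG; Martel–Merle, J. Math. Pures
Appl. 79 (2000) 339–425 (architecture). Size: XL / open-problem. -/
theorem stub_orbitalToAsymptotic : open Literature.Geometry.Lorentzian in open scoped Manifold ContDiff in ∀ (M₀ a₀ : ℝ), Kerr.IsSubextremal M₀ a₀ → ∀ ℓ : ℝ, 4 * M₀ ≤ ℓ → ∀ η : ℝ, 0 < η → ∃ δ : ℝ, 0 < δ ∧ ∀ (X : Type) [TopologicalSpace X] [ChartedSpace E3 X] [IsManifold (𝓡 3) ∞ X] [T2Space X] [SecondCountableTopology X] [ConnectedSpace X] (D : InitialDataSet (𝓡 3) X), D ∈ admissibleVacuumData X → ∀ 𝒟 : VacuumCauchyDevelopment D, 𝒟.IsMaximal → ∀ (S : Set 𝒟.carrier) (M₂ a₂ τ' : ℝ) (Ψ : (Kerr.background M₂ a₂).domain → 𝒟.carrier) (R : ℝ → ℝ), (Kerr.IsSubextremal M₂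 a₂ ∧ |M₂ - M₀| + |a₂ - a₀| ≤ δ ∧ 𝒟.toSpacetime.IsLateChart (Kerr.background M₂ a₂) (𝒟.metric.causalFuture 𝒟.timeOrientation S) τ' Ψ ∧ Filter.Tendsto R Filter.atTop Filter.atTop ∧ (∀ σ : ℝ, τ' ≤ σ → 𝒟.toSpacetime.truncDeviationCk (Kerr.background M₂ a₂) Ψ 2 (R σ) σ ≤ ENNReal.ofReal δ) ∧ (∀ ρ : ℝ, ∀ᶠ σ in Filter.atTop, ∀ x ∈ (Kerr.background M₂ a₂).truncTimeSlab ρ σ, 𝒟.timeOrientation.IsFutureDirected (mfderiv 𝓘(ℝ, E4) (𝓡 4) Ψ x (Kerr.timeVector M₂ a₂ (x : E4)))) ∧ ∀ q : 𝒟.carrier, ∃ (τ₂ : ℝ) (Φ₂ : RecedingKerr.layer (fun _ : Fin 1 ↦ M₂) (fun _ ↦ a₂) (fun _ ↦ 1) (fun _ ↦ 0) τ₂ ℓ → 𝒟.carrier), ContMDiff 𝓘(ℝ, E4) (𝓡 4) ∞ Φ₂ ∧ Topology.IsOpenEmbedding Φ₂ ∧ Set.range Φ₂ ⊆ 𝒟.metric.causalFuture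 𝒟.timeOrientation S ∧ (∀ s₀ ∈ Set.Ioo 0 ℓ, 𝒟.metric.IsAchronal 𝒟.timeOrientation (Φ₂ '' {x | RecedingKerr.layerTime τ₂ ℓ x.1 = s₀})) ∧ 𝒟.toSpacetime.recedingKerrInitialLayerNorm (fun _ : Fin 1 ↦ M₂) (fun _ ↦ a₂) (fun _ ↦ 1) (fun _ ↦ 0) τ₂ ℓ 2 (1 / 2) (1 / 2) Φ₂ ≤ ENNReal.ofReal δ ∧ q ∉ 𝒟.metric.causalFuture 𝒟.timeOrientation (Set.range Φ₂)) → ∃ (M' a' τ'' : ℝ) (Ψ' : (Kerr.background M' a').domain → 𝒟.carrier) (R' : ℝ → ℝ), Kerr.IsSubextremal M' a' ∧ |M' - M₀| + |a' - a₀| ≤ η ∧ 𝒟.toSpacetime.IsLateChart (Kerr.background M' a') (𝒟.metric.causalFuture 𝒟.timeOrientation S) τ'' Ψ' ∧ Filter.Tendsto R' Filter.atTop Filter.atTop ∧ Filter.Tendsto (fun σ ↦ 𝒟.toSpacetime.truncDeviationCk (Kerr.background M' a') Ψ' 2 (R' σ) σ) Filter.atTop (nhds 0) ∧ ∀ ρ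 : ℝ, ∀ᶠ σ in Filter.atTop, ∀ x ∈ (Kerr.background M' a').truncTimeSlab ρ σ, 𝒟.timeOrientation.IsFutureDirected (mfderiv 𝓘(ℝ, E4) (𝓡 4) Ψ' x (Kerr.timeVector M' a' (x : E4))) := by
  sorry

/-! ## Composition: the crux BY NAME from the two stubs (real proof, no `sorry`) -/

/-- **ThriftyKerrStability from K and C** — `ε/δ` plumbing: given the tolerance `η`, C supplies the
orbital level `δ` it needs; K at tolerance `δ` supplies the crux's `ε`. An `ε`-thrifty layer `Φ` then
carries an orbital certificate at level `δ` in `J⁺(range Φ)` (K), which C — instantiated at the region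
`S := range Φ` — upgrades to the crux's conclusion, verbatim. -/
theorem ThriftyKerrStability_of :
    Sig.stub_thriftOrbital → Sig.stub_orbitalToAsymptotic → ThriftyKerrStability := by
  intro hK hC M₀ a₀ hsub ℓ hℓ η hη
  -- C fixes, for the tolerance `η`, the orbital level `δ` it can digest …
  obtain ⟨δ, hδ, hC'⟩ := hC M₀ a₀ hsub ℓ hℓ η hη
  -- … and K, at tolerance `δ`, the one-time thrift `ε` that buys an orbital certificate at level `δ`.
  obtain ⟨ε, hε, hK'⟩ := hK M₀ a₀ hsub ℓ hℓ δ hδ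
  refine ⟨ε, hε, ?_⟩
  intro X _ _ _ _ _ _ D hD 𝒟 hmax τ Φ hΦ hemb hJ hachr hN
  -- orbital certificate in the region `J⁺(range Φ)` …
  obtain ⟨M₂, a₂, τ', Ψ, R, hcert⟩ := hK' X D hD 𝒟 hmax τ Φ hΦ hemb hJ hachr hN
  -- … upgraded by C (region `S := range Φ`) to the crux's near-zone conclusion, verbatim.
  exact hC' X D hD 𝒟 hmax (Set.range Φ) M₂ a₂ τ' Ψ R hcert

/-- The crux by name, closed modulo the two registered stubs. -/
theorem thriftyKerrStability_of_stubs : ThriftyKerrStability :=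
  ThriftyKerrStability_of stub_thriftOrbital stub_orbitalToAsymptotic

end Summit.FinalStateConjecture.FinalStateConjecture.Cruxes.ThriftyKerrStability.Birth

end
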